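import Summits.Ventures.LatticeQCDFlow.Scaling.SectorOfferCeiling

/-!
HONEST FRAMING: exact (Metropolis-corrected) sampling algorithms for lattice gauge theory; figures
of merit are autocorrelation/cost numbers at stated couplings and volumes; no continuum-physics
claim.

# GraphOfferCeiling — ON EVERY SWAP GRAPH A REPLICA CROSSES A SECTOR NO FASTER THAN ITS NEIGHBOURS OFFER IT THAT SECTOR:
# `Gap ≤ (t/m)·O_k(A)/μ_k(A)`, `O_k(A) = Σ_{r ∋ k} μ_{partner_r(k)}(A)`, FOR EVERY SECTOR-IDLE LEVEL `k` OF AN EXCHANGE SCHEME WITH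
# `A`-PRESERVING MAPS; AT A TIGHT SECTOR `Gap ≤ (t/m)·Σ_{r∋k} q_r` (`q_r = p'` FOR A HUB PARTNER, `1` FOR A COLD ONE) AND, ON EVERY GRAPH,
# `Gap ≤ (1−t)w_0·p'/(K(1−θ))`: BOTH BUDGETS CARRY THE QUALITY WHATEVER THE SWAP GRAPH (lean-2 GEN-29, ours)

Venture-side (OURS).  Cell `lqcd-flow` (pub-lqcd), unit `pub-lqcd-lean-2-g29`, 2026-08-28.  Chapter O (the floor sees the map quality), file 5:
`Scaling/SectorOfferCeiling` (O3) for an ARBITRARY edge list `e : Fin m → Fin (K+1) × Fin (K+1)` (distinct endpoints, one entry drawn uniformly per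
swap step, per-entry maps `φ_r` preserving `A`, Metropolis-corrected), any `0 ≤ t ≤ 1`, any allocation `w`, any `μ_j`-reversible kernels.  The edge swap
is symmetric — `edgeFlowSwap ψ i l = edgeFlowSwap ψ⁻¹ l i` — so O3's crossing acceptance `≤ 2μ_i(A)μ_l(Aᶜ)` also reads `≤ 2μ_l(A)μ_i(Aᶜ)`, and the
single-level test function of chapter K (`Scaling/HubAcceptanceLaw`) with the jump kept gives the OFFER `O_k(A)`: the `A`-mass of the partner,
summed over the entries at `k`.

## What is proved

* `edgeFlowSwap_symm_swap` — `edgeFlowSwap ψ i l x = edgeFlowSwap ψ.symm l i x` (`i ≠ l`); `crossingAcceptance_le'` — the crossing acceptance of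
  `(i,l,ψ)` is also `≤ 2·μ_l(A)·μ_i(Aᶜ)`.
* **`graphOffer_spectralGap_le`** — level `k` sector-idle (`w_k·Q_k(A,Aᶜ) = 0`), `μ_k(A)μ_k(Aᶜ) > 0`, `m ≥ 1`, `|S| ≥ 2`:
  **`Gap ≤ t·O_k(A)/(m·μ_k(A))`**, `O_k(A) = Σ_r [𝟙{l_r = k}·μ_{i_r}(A) + 𝟙{i_r = k}·μ_{l_r}(A)]`.
* **`tightSector_graphOffer_spectralGap_le`** — every cold level gives `A` mass `θ ∈ (0,1)`, the hot level `≤ p'θ`, `k ≠ 0`: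
  **`Gap ≤ (t/m)·Σ_{r ∋ k} q_r`** with `q_r = p'` for a hub partner and `q_r = 1` for a cold partner (i.e. `t·(p'·h_k + d_k)/m` with `h_k` hub entries
  and `d_k` cold entries at `k`).
* **`tightSector_graphCensus_spectralGap_le`** — exact hot redraws, all cold levels sector-idle: **`Gap ≤ (1−t)w_0·p'/(K(1−θ))`** on every swap graph
  (`Scaling/TightSectorGapLaw`'s census ceiling, which used no property of the hub list beyond count preservation).
* **`graphOffer_mixingTime_ge`** — irreducible scheme `ε`-close at some time: **`t_mix(ε) ≥ (m·μ_k(A)/(t·O_k(A)) − 1)·log(1/(2ε))`**.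

Reading (no numerics implied): the swap budget is paid per replica at the rate its NEIGHBOURS can show it the rare sector: hub entries at the
map quality (`p'θ` per entry), cold–cold entries at full sector mass (`θ` per entry) — cold replicas can pass a rare label among themselves at
full speed, but only the hot level mints labels (the census ceiling of `Scaling/TightSectorGapLaw`, `(1−t)w_0·p'/(K(1−θ))`, binds every graph).
For the hub list this is O3 (`d_k = 0`, `h_k = c_k`).  NOT CLAIMED: a matching floor on general graphs with maps (chapter K's floors are for
identity maps / level maps); anything measured.  Literature grade (cell rule): OWN RESULT; nothing cited as a fact; no new bib keys.
-/

noncomputable section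

open Finset Function
open Literature.Probability.MarkovChains

namespace Summit.Ventures.LatticeQCDFlow.Scaling

variable {S : Type*} [Fintype S] [DecidableEq S] {K m : ℕ} {μ : Fin (K + 1) → S → ℝ} {M : Fin (K + 1) → S → S → ℝ}
  {w : Fin (K + 1) → ℝ} {t : ℝ} {e : Fin m → Fin (K + 1) × Fin (K + 1)} {φ : Fin m → Equiv.Perm S}

/-! ## §1 The edge swap is symmetric; the crossing acceptance in the other orientation -/

omit [Fintype S] [DecidableEq S] in
/-- **`edgeFlowSwap ψ i l = edgeFlowSwap ψ⁻¹ l i`** (`i ≠ l`): level `i` receives `ψ⁻¹(x_l)` and level `l` receives `ψ(x_i)` either way. [ours] -/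
theorem edgeFlowSwap_symm_swap (ψ : Equiv.Perm S) {i l : Fin (K + 1)} (hil : i ≠ l) (x : Fin (K + 1) → S) :
    edgeFlowSwap ψ i l x = edgeFlowSwap ψ.symm l i x := by
  funext k
  by_cases h2 : k = l
  · subst h2
    rw [edgeFlowSwap_snd, edgeFlowSwap_fst ψ.symm (Ne.symm hil), Equiv.symm_symm]
  · by_cases h1 : k = i
    · subst h1
      rw [edgeFlowSwap_fst ψ hil, edgeFlowSwap_snd]
    · rw [edgeFlowSwap_of_ne ψ i l x h1 h2, edgeFlowSwap_of_ne ψ.symm l i x h2 h1]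

/-- **THE CROSSING ACCEPTANCE, SECOND ORIENTATION:** `Σ_x min{π̃(x), π̃(edgeFlowSwap ψ i l x)}·(𝟙_{Aᶜ}(x_i) − 𝟙_{Aᶜ}(x_l))² ≤ 2·μ_l(A)·μ_i(Aᶜ)`. [ours] -/
theorem crossingAcceptance_le' (hμ : ∀ k u, 0 < μ k u) (hμ1 : ∀ k, ∑ u, μ k u = 1) {ψ : Equiv.Perm S} {A : Finset S}
    (hψA : ∀ u, ψ u ∈ A ↔ u ∈ A) {i l : Fin (K + 1)} (hil : i ≠ l) :
    ∑ x : Fin (K + 1) → S, min (tensorFun μ x) (tensorFun μ (edgeFlowSwap ψ i l x))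
        * ((if x i ∈ A then (0 : ℝ) else 1) - (if x l ∈ A then (0 : ℝ) else 1)) ^ 2
      ≤ 2 * ((∑ u ∈ A, μ l u) * ∑ u ∈ Aᶜ, μ i u) := by
  have hψAs : ∀ v, ψ.symm v ∈ A ↔ v ∈ A := fun v => by rw [← hψA (ψ.symm v), Equiv.apply_symm_apply]
  have h := crossingAcceptance_le (μ := μ) hμ hμ1 hψAs (Ne.symm hil)
  refine le_of_eq_of_le ?_ h
  refine sum_congr rfl fun x _ => ?_
  rw [edgeFlowSwap_symm_swap ψ hil x]
  ring

/-! ## §2 The offer ceiling on every swap graph -/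

/-- **THE OFFER CEILING ON EVERY SWAP GRAPH: `Gap ≤ t·O_k(A)/(m·μ_k(A))`**, `O_k(A) = Σ_r [𝟙{l_r = k}·μ_{i_r}(A) + 𝟙{i_r = k}·μ_{l_r}(A)]`, for a
sector-idle level `k` (`w_k·Q_k(A,Aᶜ) = 0`) with `μ_k(A)μ_k(Aᶜ) > 0`; distinct endpoints, `A`-preserving maps, `0 ≤ t ≤ 1`, `w` a probability vector,
`μ_j`-reversible kernels, `m ≥ 1`, `|S| ≥ 2`. [ours] -/
theorem graphOffer_spectralGap_le [Nontrivial S] (hm : 1 ≤ m) (he : ∀ r, (e r).1 ≠ (e r).2) (hμ : ∀ k x, 0 < μ k x)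
    (hμ1 : ∀ k, ∑ u, μ k u = 1) (hM : ∀ k, IsRowStochastic (M k)) (hMrev : ∀ k, DetailedBalance (μ k) (M k))
    (hw0 : ∀ k, 0 ≤ w k) (hw1 : ∑ k, w k = 1) (ht0 : 0 ≤ t) (ht1 : t ≤ 1) {A : Finset S} (hφA : ∀ r u, φ r u ∈ A ↔ u ∈ A)
    (k : Fin (K + 1)) (hAk : 0 < (∑ u ∈ A, μ k u) * ∑ u ∈ Aᶜ, μ k u) (hidle : w k * edgeMeasure (μ k) (M k) A Aᶜ = 0) :
    spectralGap (tensorFun μ) (fun x y : Fin (K + 1) → S => t * ptGraphSwap μ e φ x y + (1 - t) * prodKernel w M x y)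
      ≤ t * (∑ r : Fin m, ((if (e r).2 = k then ∑ u ∈ A, μ (e r).1 u else 0) + (if (e r).1 = k then ∑ u ∈ A, μ (e r).2 u else 0)))
          / (m * ∑ u ∈ A, μ k u) := by
  have hmpos : (0 : ℝ) < m := Nat.cast_pos.mpr (by omega)
  set a : Fin (K + 1) → ℝ := fun i => if i = k then (1 : ℝ) else 0 with ha
  set G : (Fin (K + 1) → S) → ℝ := fun x => ∑ i, a i * bottleneckTestFun (μ i) A (x i) with hG
  have hQ := ptGraphSwap_isRowStochastic (e := e) (φ := φ) hμ
  have hQrev := ptGraphSwap_detailedBalance (e := e) (φ := φ) hμ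
  have hP := weightedScheme_isRowStochastic (t := t) (w := w) hQ hM hw0 hw1 ht0 ht1
  have hDB := weightedScheme_detailedBalance (w := w) hQrev hMrev t
  have hden : ∑ i, a i ^ 2 * ((∑ u ∈ A, μ i u) * ∑ u ∈ Aᶜ, μ i u) = (∑ u ∈ A, μ k u) * ∑ u ∈ Aᶜ, μ k u := by
    simp_rw [ha, ite_pow, one_pow, zero_pow two_ne_zero, ite_mul, one_mul, zero_mul]
    rw [Finset.sum_ite_eq' univ k, if_pos (mem_univ _)]
  have hupd : ∑ i, w i * (a i ^ 2 * edgeMeasure (μ i) (M i) A Aᶜ) = 0 := by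
    simp_rw [ha, ite_pow, one_pow, zero_pow two_ne_zero, ite_mul, one_mul, zero_mul, mul_ite, mul_zero]
    rw [Finset.sum_ite_eq' univ k, if_pos (mem_univ _)]; exact hidle
  have hray := LevinPeres2017_lemma_13_7_rayleigh (tensorFun_pos hμ) (sum_tensorFun_eq_one μ hμ1) hP hDB
    (ptBare_mean_profileCount (μ := μ) hμ1 a A)
  rw [ptBare_piInner_profileCount hμ1 a A, weightedScheme_dirichletForm (Q := ptGraphSwap μ e φ) (w := w) (M := M),
    prodKernel_dirichletForm_profileCount hμ1 hM hMrev w a A, hden, hupd, mul_zero, add_zero] at hray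
  have hsw := ptGraph_dirichletForm_swap_le_acc (e := e) (φ := φ) hμ he G
  have hak : ∀ i, a i = if i = k then (1 : ℝ) else 0 := fun i => by rw [ha]
  -- entry by entry: the crossing acceptance in the right orientation, nothing off `k`
  have hentry : ∀ r : Fin m, ∑ x : Fin (K + 1) → S,
        min (tensorFun μ x) (tensorFun μ (edgeFlowSwap (φ r) (e r).1 (e r).2 x))
          * (G x - G (edgeFlowSwap (φ r) (e r).1 (e r).2 x)) ^ 2
      ≤ ((if (e r).2 = k then ∑ u ∈ A, μ (e r).1 u else 0) + (if (e r).1 = k then ∑ u ∈ A, μ (e r).2 u else 0))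
          * (2 * ∑ u ∈ Aᶜ, μ k u) := by
    intro r
    have hsq : ∀ x : Fin (K + 1) → S, (G x - G (edgeFlowSwap (φ r) (e r).1 (e r).2 x)) ^ 2
        = (a (e r).1 - a (e r).2) ^ 2
          * ((if x (e r).1 ∈ A then (0 : ℝ) else 1) - (if x (e r).2 ∈ A then (0 : ℝ) else 1)) ^ 2 := by
      intro x
      rw [hG]
      simp only
      rw [graphProfileCount_sub_swap hμ1 a (hφA r) (he r) x, mul_pow]
    simp_rw [hsq]
    have hA0 : ∀ j : Fin (K + 1), 0 ≤ ∑ u ∈ A, μ j u := fun j => sum_nonneg fun u _ => (hμ j u).le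
    have hAc0 : 0 ≤ ∑ u ∈ Aᶜ, μ k u := sum_nonneg fun u _ => (hμ k u).le
    by_cases h2 : (e r).2 = k
    · have h1 : (e r).1 ≠ k := fun h1 => he r (h1.trans h2.symm)
      have ha1 : a (e r).1 = 0 := by rw [hak, if_neg h1]
      have ha2 : a (e r).2 = 1 := by rw [hak, if_pos h2]
      rw [if_pos h2, if_neg h1, ha1, ha2, add_zero]
      have e1 : ∀ x : Fin (K + 1) → S, min (tensorFun μ x) (tensorFun μ (edgeFlowSwap (φ r) (e r).1 (e r).2 x))
          * (((0 : ℝ) - 1) ^ 2 * ((if x (e r).1 ∈ A then (0 : ℝ) else 1) - (if x (e r).2 ∈ A then (0 : ℝ) else 1)) ^ 2)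
          = min (tensorFun μ x) (tensorFun μ (edgeFlowSwap (φ r) (e r).1 (e r).2 x))
          * ((if x (e r).1 ∈ A then (0 : ℝ) else 1) - (if x (e r).2 ∈ A then (0 : ℝ) else 1)) ^ 2 := by
        intro x; ring
      simp_rw [e1]
      have h := crossingAcceptance_le (μ := μ) hμ hμ1 (hφA r) (he r)
      calc _ ≤ 2 * ((∑ u ∈ A, μ (e r).1 u) * ∑ u ∈ Aᶜ, μ (e r).2 u) := h
        _ = (∑ u ∈ A, μ (e r).1 u) * (2 * ∑ u ∈ Aᶜ, μ k u) := by rw [h2]; ring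
    · by_cases h1 : (e r).1 = k
      · have ha1 : a (e r).1 = 1 := by rw [hak, if_pos h1]
        have ha2 : a (e r).2 = 0 := by rw [hak, if_neg h2]
        rw [if_neg h2, if_pos h1, ha1, ha2, zero_add]
        have e1 : ∀ x : Fin (K + 1) → S, min (tensorFun μ x) (tensorFun μ (edgeFlowSwap (φ r) (e r).1 (e r).2 x))
            * (((1 : ℝ) - 0) ^ 2 * ((if x (e r).1 ∈ A then (0 : ℝ) else 1) - (if x (e r).2 ∈ A then (0 : ℝ) else 1)) ^ 2)
            = min (tensorFun μ x) (tensorFun μ (edgeFlowSwap (φ r) (e r).1 (e r).2 x))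
            * ((if x (e r).1 ∈ A then (0 : ℝ) else 1) - (if x (e r).2 ∈ A then (0 : ℝ) else 1)) ^ 2 := by
          intro x; ring
        simp_rw [e1]
        have h := crossingAcceptance_le' (μ := μ) hμ hμ1 (hφA r) (he r)
        calc _ ≤ 2 * ((∑ u ∈ A, μ (e r).2 u) * ∑ u ∈ Aᶜ, μ (e r).1 u) := h
          _ = (∑ u ∈ A, μ (e r).2 u) * (2 * ∑ u ∈ Aᶜ, μ k u) := by rw [h1]; ring
      · have ha1 : a (e r).1 = 0 := by rw [hak, if_neg h1]
        have ha2 : a (e r).2 = 0 := by rw [hak, if_neg h2]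
        rw [if_neg h2, if_neg h1, ha1, ha2, add_zero, zero_mul]
        refine Finset.sum_nonpos fun x _ => ?_
        have : ((0 : ℝ) - 0) ^ 2 * ((if x (e r).1 ∈ A then (0 : ℝ) else 1) - (if x (e r).2 ∈ A then (0 : ℝ) else 1)) ^ 2 = 0 := by
          ring
        rw [this, mul_zero]
  have hsum : ∑ r : Fin m, ∑ x : Fin (K + 1) → S,
        min (tensorFun μ x) (tensorFun μ (edgeFlowSwap (φ r) (e r).1 (e r).2 x))
          * (G x - G (edgeFlowSwap (φ r) (e r).1 (e r).2 x)) ^ 2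
      ≤ (∑ r : Fin m, ((if (e r).2 = k then ∑ u ∈ A, μ (e r).1 u else 0) + (if (e r).1 = k then ∑ u ∈ A, μ (e r).2 u else 0)))
          * (2 * ∑ u ∈ Aᶜ, μ k u) := by
    rw [Finset.sum_mul]
    exact sum_le_sum fun r _ => hentry r
  have hAc : 0 < ∑ u ∈ Aᶜ, μ k u := by
    rcases (mul_pos_iff.mp hAk) with ⟨_, h⟩ | ⟨h1, _⟩
    · exact h
    · exact absurd h1 (not_lt.mpr (sum_nonneg fun u _ => (hμ _ u).le))
  have hA : 0 < ∑ u ∈ A, μ k u := by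
    rcases (mul_pos_iff.mp hAk) with ⟨h, _⟩ | ⟨_, h2⟩
    · exact h
    · exact absurd h2 (not_lt.mpr (sum_nonneg fun u _ => (hμ _ u).le))
  set O : ℝ := ∑ r : Fin m, ((if (e r).2 = k then ∑ u ∈ A, μ (e r).1 u else 0) + (if (e r).1 = k then ∑ u ∈ A, μ (e r).2 u else 0))
    with hO
  rw [le_div_iff₀ (by positivity)]
  have hstep : spectralGap (tensorFun μ) (fun x y : Fin (K + 1) → S => t * ptGraphSwap μ e φ x y + (1 - t) * prodKernel w M x y)
      * ((∑ u ∈ A, μ k u) * ∑ u ∈ Aᶜ, μ k u) ≤ t * (1 / (2 * m) * (O * (2 * ∑ u ∈ Aᶜ, μ k u))) := by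
    refine hray.trans ?_
    exact mul_le_mul_of_nonneg_left (hsw.trans (mul_le_mul_of_nonneg_left hsum (by positivity))) ht0
  have e1 : spectralGap (tensorFun μ) (fun x y : Fin (K + 1) → S => t * ptGraphSwap μ e φ x y + (1 - t) * prodKernel w M x y)
      * (m * ∑ u ∈ A, μ k u)
      = (spectralGap (tensorFun μ) (fun x y : Fin (K + 1) → S => t * ptGraphSwap μ e φ x y + (1 - t) * prodKernel w M x y)
          * ((∑ u ∈ A, μ k u) * ∑ u ∈ Aᶜ, μ k u)) * (m / ∑ u ∈ Aᶜ, μ k u) := by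
    field_simp
  have e2 : t * O = t * (1 / (2 * m) * (O * (2 * ∑ u ∈ Aᶜ, μ k u))) * (m / ∑ u ∈ Aᶜ, μ k u) := by
    field_simp
  rw [e1, e2]
  exact mul_le_mul_of_nonneg_right hstep (by positivity)

/-! ## §3 At a tight sector: hub entries at the quality, cold entries at full mass -/

/-- **`Gap ≤ (t/m)·Σ_{r ∋ k} q_r` AT A TIGHT SECTOR ON EVERY SWAP GRAPH**, `q_r = p'` when the partner of `k` in entry `r` is the hot level and
`q_r = 1` when it is a cold level (`k ≠ 0` sector-idle; every cold level gives `A` mass `θ ∈ (0,1)`, the hot level `≤ p'θ`). [ours] -/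
theorem tightSector_graphOffer_spectralGap_le [Nontrivial S] (hm : 1 ≤ m) (he : ∀ r, (e r).1 ≠ (e r).2) (hμ : ∀ k x, 0 < μ k x)
    (hμ1 : ∀ k, ∑ u, μ k u = 1) (hM : ∀ k, IsRowStochastic (M k)) (hMrev : ∀ k, DetailedBalance (μ k) (M k))
    (hw0 : ∀ k, 0 ≤ w k) (hw1 : ∑ k, w k = 1) (ht0 : 0 ≤ t) (ht1 : t ≤ 1) {A : Finset S} (hφA : ∀ r u, φ r u ∈ A ↔ u ∈ A)
    {θ p' : ℝ} (hθ0 : 0 < θ) (hθ1 : θ < 1) (hcold : ∀ j : Fin (K + 1), j ≠ 0 → ∑ u ∈ A, μ j u = θ)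
    (hhot : ∑ u ∈ A, μ 0 u ≤ p' * θ) (k : Fin (K + 1)) (hk : k ≠ 0) (hidle : w k * edgeMeasure (μ k) (M k) A Aᶜ = 0) :
    spectralGap (tensorFun μ) (fun x y : Fin (K + 1) → S => t * ptGraphSwap μ e φ x y + (1 - t) * prodKernel w M x y)
      ≤ t * (∑ r : Fin m, ((if (e r).2 = k then (if (e r).1 = 0 then p' else 1) else 0)
              + (if (e r).1 = k then (if (e r).2 = 0 then p' else 1) else 0))) / m := by
  have hmpos : (0 : ℝ) < m := Nat.cast_pos.mpr (by omega)
  have h1θ : 0 < 1 - θ := by linarith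
  have hAk : 0 < (∑ u ∈ A, μ k u) * ∑ u ∈ Aᶜ, μ k u := by
    rw [tightSector_coldBalance_eq hμ1 hcold k hk]; exact mul_pos hθ0 h1θ
  have h := graphOffer_spectralGap_le hm he hμ hμ1 hM hMrev hw0 hw1 ht0 ht1 hφA k hAk hidle
  rw [hcold k hk] at h
  refine h.trans ?_
  -- the `A`-mass of any level `j` is at most `θ·(if j = 0 then p' else 1)`
  have hmass : ∀ j : Fin (K + 1), ∑ u ∈ A, μ j u ≤ θ * (if j = 0 then p' else 1) := by
    intro j
    by_cases hj : j = 0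
    · rw [if_pos hj, hj, mul_comm]; exact hhot
    · rw [if_neg hj, mul_one, hcold j hj]
  have hterm : ∀ r : Fin m,
      ((if (e r).2 = k then ∑ u ∈ A, μ (e r).1 u else 0) + (if (e r).1 = k then ∑ u ∈ A, μ (e r).2 u else 0))
        ≤ θ * ((if (e r).2 = k then (if (e r).1 = 0 then p' else 1) else 0)
            + (if (e r).1 = k then (if (e r).2 = 0 then p' else 1) else 0)) := by
    intro r
    rw [mul_add]
    refine add_le_add ?_ ?_
    · by_cases h2 : (e r).2 = k
      · rw [if_pos h2, if_pos h2]; exact hmass _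
      · rw [if_neg h2, if_neg h2, mul_zero]
    · by_cases h1 : (e r).1 = k
      · rw [if_pos h1, if_pos h1]; exact hmass _
      · rw [if_neg h1, if_neg h1, mul_zero]
  have hsum := sum_le_sum fun r (_ : r ∈ (univ : Finset (Fin m))) => hterm r
  rw [← mul_sum] at hsum
  rw [div_le_div_iff₀ (by positivity) hmpos]
  calc t * (∑ r : Fin m, ((if (e r).2 = k then ∑ u ∈ A, μ (e r).1 u else 0) + (if (e r).1 = k then ∑ u ∈ A, μ (e r).2 u else 0))) * m
      ≤ t * (θ * ∑ r : Fin m, ((if (e r).2 = k then (if (e r).1 = 0 then p' else 1) else 0)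
              + (if (e r).1 = k then (if (e r).2 = 0 then p' else 1) else 0))) * m :=
        mul_le_mul_of_nonneg_right (mul_le_mul_of_nonneg_left hsum ht0) hmpos.le
    _ = t * (∑ r : Fin m, ((if (e r).2 = k then (if (e r).1 = 0 then p' else 1) else 0)
              + (if (e r).1 = k then (if (e r).2 = 0 then p' else 1) else 0))) * (m * θ) := by
        ring

/-! ## §4 The census ceiling on every swap graph -/

/-- **THE REFRESH CEILING ON EVERY SWAP GRAPH AT A TIGHT SECTOR: `Gap ≤ (1−t)w_0·p'/(K(1−θ))`** — the swaps of any edge list with `A`-preserving maps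
keep the sector count, the sector-idle cold kernels do not move it, only the exact hot redraw mints labels (`Q_0(A,Aᶜ) ≤ p'θ`) against the count's
variance `≥ Kθ(1−θ)`; distinct endpoints, `0 ≤ t ≤ 1`, `w` a probability vector, `K ≥ 1`, `|S| ≥ 2`. [ours] -/
theorem tightSector_graphCensus_spectralGap_le [Nontrivial S] (hK : 1 ≤ K) (he : ∀ r, (e r).1 ≠ (e r).2) (hμ : ∀ k x, 0 < μ k x)
    (hμ1 : ∀ k, ∑ u, μ k u = 1) (hM : ∀ k, IsRowStochastic (M k)) (hMrev : ∀ k, DetailedBalance (μ k) (M k))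
    (hM0 : ∀ u v, M 0 u v = μ 0 v) (hw0 : ∀ k, 0 ≤ w k) (hw1 : ∑ k, w k = 1) (ht0 : 0 ≤ t) (ht1 : t ≤ 1)
    {A : Finset S} (hφA : ∀ r u, φ r u ∈ A ↔ u ∈ A) {θ p' : ℝ} (hθ0 : 0 < θ) (hθ1 : θ < 1)
    (hcold : ∀ k : Fin (K + 1), k ≠ 0 → ∑ u ∈ A, μ k u = θ) (hhot : ∑ u ∈ A, μ 0 u ≤ p' * θ)
    (hidle : ∀ k : Fin (K + 1), k ≠ 0 → w k * edgeMeasure (μ k) (M k) A Aᶜ = 0) :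
    spectralGap (tensorFun μ) (fun x y : Fin (K + 1) → S => t * ptGraphSwap μ e φ x y + (1 - t) * prodKernel w M x y)
      ≤ (1 - t) * w 0 * p' / (K * (1 - θ)) := by
  have hKpos : (0 : ℝ) < K := Nat.cast_pos.mpr (by omega)
  have h1θ : 0 < 1 - θ := by linarith
  have h1t : 0 ≤ 1 - t := by linarith
  have hQ := ptGraphSwap_isRowStochastic (e := e) (φ := φ) hμ
  have hQrev := ptGraphSwap_detailedBalance (e := e) (φ := φ) hμ
  have hQA := ptGraphSwap_sectorCount_eq (μ := μ) he hμ hφA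
  have hbal0 : 0 ≤ (∑ u ∈ A, μ 0 u) * ∑ u ∈ Aᶜ, μ 0 u :=
    mul_nonneg (sum_nonneg fun u _ => (hμ 0 u).le) (sum_nonneg fun u _ => (hμ 0 u).le)
  have hV : (K : ℝ) * (θ * (1 - θ)) ≤ ∑ k : Fin (K + 1), (∑ u ∈ A, μ k u) * ∑ u ∈ Aᶜ, μ k u := by
    rw [Fin.sum_univ_succ]
    have hc : ∑ k : Fin K, (∑ u ∈ A, μ k.succ u) * ∑ u ∈ Aᶜ, μ k.succ u = K * (θ * (1 - θ)) := by
      rw [sum_congr rfl fun k _ => tightSector_coldBalance_eq hμ1 hcold k.succ (Fin.succ_ne_zero k), sum_const,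
        Finset.card_univ, Fintype.card_fin, nsmul_eq_mul]
    rw [hc]
    linarith
  have hVpos : 0 < ∑ k : Fin (K + 1), (∑ u ∈ A, μ k u) * ∑ u ∈ Aᶜ, μ k u :=
    lt_of_lt_of_le (mul_pos hKpos (mul_pos hθ0 h1θ)) hV
  have h := weightedScheme_spectralGap_le_sectorCount (w := w) hμ hμ1 hM hMrev hw0 hw1 ht0 ht1 hQ hQrev hQA hVpos
  have hsum : ∑ k : Fin (K + 1), w k * edgeMeasure (μ k) (M k) A Aᶜ = w 0 * ((∑ u ∈ A, μ 0 u) * ∑ u ∈ Aᶜ, μ 0 u) := by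
    rw [Finset.sum_eq_single (0 : Fin (K + 1)) (fun k _ hk => hidle k hk) (fun h => absurd (mem_univ _) h),
      exactSampler_edgeMeasure hM0 A]
  rw [hsum] at h
  refine h.trans ?_
  have hAc1 : ∑ u ∈ Aᶜ, μ 0 u ≤ 1 := by
    have hs : ∑ u ∈ A, μ 0 u + ∑ u ∈ Aᶜ, μ 0 u = 1 := by rw [Finset.sum_add_sum_compl, hμ1 0]
    linarith [sum_nonneg fun u (_ : u ∈ A) => (hμ 0 u).le]
  have hQ0 : (∑ u ∈ A, μ 0 u) * ∑ u ∈ Aᶜ, μ 0 u ≤ p' * θ := by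
    calc (∑ u ∈ A, μ 0 u) * ∑ u ∈ Aᶜ, μ 0 u ≤ (∑ u ∈ A, μ 0 u) * 1 :=
          mul_le_mul_of_nonneg_left hAc1 (sum_nonneg fun u _ => (hμ 0 u).le)
      _ ≤ p' * θ := by rw [mul_one]; exact hhot
  have hnum0 : 0 ≤ (1 - t) * (w 0 * ((∑ u ∈ A, μ 0 u) * ∑ u ∈ Aᶜ, μ 0 u)) := mul_nonneg h1t (mul_nonneg (hw0 0) hbal0)
  calc (1 - t) * (w 0 * ((∑ u ∈ A, μ 0 u) * ∑ u ∈ Aᶜ, μ 0 u)) / ∑ k : Fin (K + 1), (∑ u ∈ A, μ k u) * ∑ u ∈ Aᶜ, μ k u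
      ≤ (1 - t) * (w 0 * ((∑ u ∈ A, μ 0 u) * ∑ u ∈ Aᶜ, μ 0 u)) / (K * (θ * (1 - θ))) :=
        div_le_div_of_nonneg_left hnum0 (by positivity) hV
    _ ≤ (1 - t) * (w 0 * (p' * θ)) / (K * (θ * (1 - θ))) :=
        div_le_div_of_nonneg_right (mul_le_mul_of_nonneg_left (mul_le_mul_of_nonneg_left hQ0 (hw0 0)) h1t) (by positivity)
    _ = (1 - t) * w 0 * p' / (K * (1 - θ)) := by
        field_simp

/-! ## §5 The cold-start floor per replica on every swap graph -/

/-- **`t_mix(ε) ≥ (m·μ_k(A)/(t·O_k(A)) − 1)·log(1/(2ε))`** for a sector-idle level `k` of an irreducible exchange scheme on any swap graph that is `ε`-close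
to `π̃` at some time (`0 < ε ≤ ½`, `t·O_k(A) < m·μ_k(A)`; hypotheses of §2). [ours] -/
theorem graphOffer_mixingTime_ge [Nontrivial S] (hm : 1 ≤ m) (he : ∀ r, (e r).1 ≠ (e r).2) (hμ : ∀ k x, 0 < μ k x)
    (hμ1 : ∀ k, ∑ u, μ k u = 1) (hM : ∀ k, IsRowStochastic (M k)) (hMrev : ∀ k, DetailedBalance (μ k) (M k))
    (hw0 : ∀ k, 0 ≤ w k) (hw1 : ∑ k, w k = 1) (ht0 : 0 ≤ t) (ht1 : t ≤ 1) {A : Finset S} (hφA : ∀ r u, φ r u ∈ A ↔ u ∈ A)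
    (k : Fin (K + 1)) (hAk : 0 < (∑ u ∈ A, μ k u) * ∑ u ∈ Aᶜ, μ k u) (hidle : w k * edgeMeasure (μ k) (M k) A Aᶜ = 0)
    (hsmall : t * (∑ r : Fin m, ((if (e r).2 = k then ∑ u ∈ A, μ (e r).1 u else 0) + (if (e r).1 = k then ∑ u ∈ A, μ (e r).2 u else 0)))
      < m * ∑ u ∈ A, μ k u)
    (hirr : IsIrreducible (fun x y : Fin (K + 1) → S => t * ptGraphSwap μ e φ x y + (1 - t) * prodKernel w M x y))
    {ε : ℝ} (hε : 0 < ε) (hε2 : ε ≤ 1 / 2)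
    (hmix : ∃ n, worstTvDist (fun x y : Fin (K + 1) → S => t * ptGraphSwap μ e φ x y + (1 - t) * prodKernel w M x y)
      (tensorFun μ) n ≤ ε) :
    (m * (∑ u ∈ A, μ k u)
        / (t * ∑ r : Fin m, ((if (e r).2 = k then ∑ u ∈ A, μ (e r).1 u else 0) + (if (e r).1 = k then ∑ u ∈ A, μ (e r).2 u else 0))) - 1)
        * Real.log (1 / (2 * ε))
      ≤ (mixingTime (fun x y : Fin (K + 1) → S => t * ptGraphSwap μ e φ x y + (1 - t) * prodKernel w M x y) (tensorFun μ) ε : ℝ) := by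
  have hmpos : (0 : ℝ) < m := Nat.cast_pos.mpr (by omega)
  have hA : 0 < ∑ u ∈ A, μ k u := by
    rcases (mul_pos_iff.mp hAk) with ⟨h, _⟩ | ⟨_, h2⟩
    · exact h
    · exact absurd h2 (not_lt.mpr (sum_nonneg fun u _ => (hμ _ u).le))
  have hP := weightedScheme_isRowStochastic (t := t) (w := w) (ptGraphSwap_isRowStochastic (e := e) (φ := φ) hμ) hM hw0 hw1 ht0 ht1
  have hDB := weightedScheme_detailedBalance (w := w) (ptGraphSwap_detailedBalance (e := e) (φ := φ) hμ) hMrev t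
  have hgap := graphOffer_spectralGap_le hm he hμ hμ1 hM hMrev hw0 hw1 ht0 ht1 hφA k hAk hidle
  have hu : t * (∑ r : Fin m, ((if (e r).2 = k then ∑ u ∈ A, μ (e r).1 u else 0) + (if (e r).1 = k then ∑ u ∈ A, μ (e r).2 u else 0)))
      / (m * ∑ u ∈ A, μ k u) < 1 := by
    rw [div_lt_one (by positivity)]; exact hsmall
  rw [show (m : ℝ) * (∑ u ∈ A, μ k u)
        / (t * ∑ r : Fin m, ((if (e r).2 = k then ∑ u ∈ A, μ (e r).1 u else 0) + (if (e r).1 = k then ∑ u ∈ A, μ (e r).2 u else 0))) - 1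
      = 1 / (t * (∑ r : Fin m, ((if (e r).2 = k then ∑ u ∈ A, μ (e r).1 u else 0) + (if (e r).1 = k then ∑ u ∈ A, μ (e r).2 u else 0)))
        / (m * ∑ u ∈ A, μ k u)) - 1 by rw [one_div_div]]
  exact mixingTime_ge_of_spectralGap_le (tensorFun_pos hμ) (sum_tensorFun_eq_one μ hμ1) hP hDB hirr hgap hu hε hε2 hmix

end Summit.Ventures.LatticeQCDFlow.Scaling

end
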